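/-
Copyright: seat `ym-line-cbag-p2` (prover-ym-line-cbag-p2-g0-0), route `ColdBoxAllGroups`, crux `BulkAllGroups`
(stmt-QuantumFields-22255), line `dlr-chessboard-G` (skeleton `Cruxes/BulkAllGroups/Lines/birth.lean`).
-/
import Summits.QuantumFields.YangMills.Theorems.ColdBoxAllGroupsDefs
import Summits.QuantumFields.YangMills.Theorems.WeakCouplingRatesBulkDominatesColdBoxWMeanSmoothOfExpansion
import Summits.QuantumFields.YangMills.Theorems.EquipartitionCriticalityFreeEnergyLogCoefficientDefs

/-!
# Crux `BulkAllGroups` (stmt-QuantumFields-22255): stub L1b-G `stub_goodBoundaryMeanSmoothG` REDUCED to the one-scale kernel mean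
# expansion (N2-G, mean form) and the flatness of the Dirichlet variance (N1′, G-free, LANDED) — the G-port of
# `WeakCouplingRatesBulkDominatesColdBoxWMeanSmoothOfExpansion`

For every compact `G`, unitary `ρ` of degree `N` with `D = dimE ρ` chart coordinates, and every `θ` below a ceiling, along the registered
family `(A, δ) = (θ/20, θ/5)`: IF (N2-G, mean form) the deep kernel means of the `(1,2)`-plaquette cost expand, uniformly over crude-good
data `ω`, as `β·E_ω[c_q] = (D/2)·V_D(q) + β·Σ_{c<D} F̄_c(q)² ± β^{−θ}` at every base point within `H/8` of the centre, with one-colour Dirichlet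
data `ϑ c` and competitors of total energy `≤ CE(2H+3)⁴β^{2δ−1}`, and IF (N1′) the D1′ variance is flat near the centre,
`|V_D(q) − V_D(q′)| ≤ K_N/H`, THEN `GoodBoundaryMeanSmoothG ρ (θ/20) θ (θ/5)`: `|E_ω c_{p+Te₀} − E_ω c_p| ≤ K·β^{2δ−1}·T/H` with
`K = 4 + (D/2)|K_N| + 1250·|CE|·C²` (`C` = the interior-estimate constant of the G-free `dirBackground_interior_bounds`).  The proof is the
`SU(2)` one verbatim (`goodBoundaryMeanSmooth_of_expansion_explicit`, constants `3/2 ↦ D/2`, `16 ↦ CE`): the background term is telescoped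
over the `T` unit steps from the centre, each step `|F̄_c(x+e₀)² − F̄_c(x)²| ≤ (C√E_c/H³)·(2C√E_c/H²)` by the interior sup and GRADIENT bounds.
The two interfaces are UNFOLDED here (their named forms `KernelMeanExpansionG` / `DirKernelDiagFlat` give the one-line corollary once the
former lands in `ColdBoxAllGroupsDefs`).  No new definition; standard axioms.  NOT a claim about the mass gap; the Yang–Mills mass gap is NOT
proved by any of this.
-/

set_option autoImplicit false

noncomputable section

open MeasureTheory Finset Matrix
open Literature.Probability.LatticeModels
open Literature.MathematicalPhysics.QuantumLattice
open Literature.MathematicalPhysics.QuantumFieldTheory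
open Literature.MathematicalPhysics.QuantumFieldTheory.LatticeMaxwell
open Literature.MathematicalPhysics.QuantumFieldTheory.AxialGauge
open Literature.MathematicalPhysics.QuantumFieldTheory.LatticeChain
open Literature.MathematicalPhysics.QuantumFieldTheory.LatticeForm (e d₁ d₁_swap)
open Summit.QuantumFields.YangMills.Theorems.WeakCouplingRates
open Summit.QuantumFields.YangMills.Theorems.FreeEnergyLogCoefficient (dimE)

namespace Summit.QuantumFields.YangMills.Theorems.ColdBoxAllGroups

variable {N : ℕ} {G : Type*} [Group G] [TopologicalSpace G] [IsTopologicalGroup G] [CompactSpace G]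
  [MeasurableSpace G] [BorelSpace G]
variable (ρ : G →* Matrix (Fin N) (Fin N) ℂ)

/-- **L1b-G ⇐ N2-G (mean expansion) ∧ N1′ (flat Dirichlet variance)**, any `G`, with both interfaces unfolded; see the module docstring.
[folklore] -/
theorem goodBoundaryMeanSmoothG_of_expansion_explicit {θ₂ : ℝ} (hθ₂ : 0 < θ₂)
    (hexp : ∀ θ : ℝ, 0 < θ → θ ≤ θ₂ →
      ∃ CE : ℝ, ∃ β₀ : ℝ, ∀ β : ℝ, β₀ ≤ β → ∀ ω : LGConfig 4 G, CrudeGoodG ρ β (θ / 5) ⌈β ^ θ⌉₊ ω →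
        ∃ ϑ : Fin (dimE ρ) → (Literature.MathematicalPhysics.QuantumLattice.ZdEdge 4 → ℝ), ∃ s : Fin (dimE ρ) → (DirFree ⌈β ^ θ⌉₊ → ℝ),
          (∑ c, LatticeMaxwell.formM (fun e => e ∉ dirFreeEdges ⌈β ^ θ⌉₊) dirCorner (2 * ⌈β ^ θ⌉₊ + 3) (ϑ c) (s c) ≤
              CE * (2 * (⌈β ^ θ⌉₊ : ℝ) + 3) ^ 4 * β ^ (2 * (θ / 5) - 1)) ∧
          ∀ x : Site 4, (∀ m : Fin 4, 8 * |x m - (⌈β ^ θ⌉₊ : ℤ)| ≤ (⌈β ^ θ⌉₊ : ℤ)) →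
            |β * (∫ U, plaqCostAt ρ x 1 2 U ∂(boxKernelG ρ β ⌈β ^ θ⌉₊ ω)) -
                (dimE ρ : ℝ) / 2 * boxDirProjKernel ⌈β ^ θ⌉₊ (x, 1, 2) (x, 1, 2) -
                β * ∑ c, LatticeMaxwell.sCirc (LatticeMaxwell.glue (pin := fun e => e ∉ dirFreeEdges ⌈β ^ θ⌉₊) dirCorner
                  (2 * ⌈β ^ θ⌉₊ + 3) (ϑ c) (LatticeMaxwell.mean (fun e => e ∉ dirFreeEdges ⌈β ^ θ⌉₊) dirCorner (2 * ⌈β ^ θ⌉₊ + 3)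
                    (ϑ c))) (x, 1, 2) ^ 2| ≤ β ^ (-θ))
    (hflat : ∃ K : ℝ, ∃ H₀ : ℕ, ∀ H : ℕ, H₀ ≤ H → ∀ x x' : Site 4,
      (∀ m : Fin 4, 8 * |x m - (H : ℤ)| ≤ (H : ℤ)) → (∀ m : Fin 4, 8 * |x' m - (H : ℤ)| ≤ (H : ℤ)) →
        |boxDirProjKernel H (x, 1, 2) (x, 1, 2) - boxDirProjKernel H (x', 1, 2) (x', 1, 2)| ≤ K / H) :
    ∃ θ₁ : ℝ, 0 < θ₁ ∧ ∀ θ : ℝ, 0 < θ → θ ≤ θ₁ → GoodBoundaryMeanSmoothG ρ (θ / 20) θ (θ / 5) := by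
  obtain ⟨KN, H₀, hN⟩ := hflat
  obtain ⟨C, hC0, hI⟩ := dirBackground_interior_bounds
  refine ⟨θ₂, hθ₂, fun θ hθ hθle => ?_⟩
  obtain ⟨CE, β₁, hE⟩ := hexp θ hθ hθle
  set A : ℝ := θ / 20 with hA
  set δ : ℝ := θ / 5 with hδ
  have hA0 : 0 < A := by rw [hA]; positivity
  have hAθ : 0 < θ - A := by rw [hA]; linarith
  -- thresholds: β ≥ β₁, β ≥ 1, β^θ ≥ max H₀ 8, β^{θ−A} ≥ 16
  set N₀ : ℝ := max (H₀ : ℝ) 8 with hN₀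
  refine ⟨4 + (dimE ρ : ℝ) / 2 * |KN| + 1250 * |CE| * C ^ 2,
    max (max β₁ 1) (max (N₀ ^ (1 / θ)) ((16 : ℝ) ^ (1 / (θ - A)))), fun β hβ ω hω => ?_⟩
  have hβ₁ : β₁ ≤ β := le_trans (le_trans (le_max_left _ _) (le_max_left _ _)) hβ
  have hβ1 : (1 : ℝ) ≤ β := le_trans (le_trans (le_max_right _ _) (le_max_left _ _)) hβ
  have hβ0 : 0 < β := by linarith
  have hN₀β : N₀ ≤ β ^ θ :=
    le_rpow_of_root_le (by rw [hN₀]; positivity) hθ (le_trans (le_trans (le_max_left _ _) (le_max_right _ _)) hβ)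
  have h16 : (16 : ℝ) ≤ β ^ (θ - A) :=
    le_rpow_of_root_le (by norm_num) hAθ (le_trans (le_trans (le_max_right _ _) (le_max_right _ _)) hβ)
  set H : ℕ := ⌈β ^ θ⌉₊ with hHdef
  set T : ℕ := ⌈β ^ A⌉₊ with hTdef
  obtain ⟨hT1, hT2⟩ := one_le_ceil_rpow_and_le hβ1 hA0.le
  obtain ⟨hH1, hH2⟩ := one_le_ceil_rpow_and_le hβ1 hθ.le
  rw [← hTdef] at hT1 hT2
  rw [← hHdef] at hH1 hH2
  have hHceil : β ^ θ ≤ (H : ℝ) := Nat.le_ceil _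
  have hH8 : 8 ≤ H := by
    have : (8 : ℝ) ≤ H := le_trans (le_trans (le_max_right _ _) hN₀β) hHceil
    exact_mod_cast this
  have hHH₀ : H₀ ≤ H := by
    have : (H₀ : ℝ) ≤ H := le_trans (le_trans (le_max_left _ _) hN₀β) hHceil
    exact_mod_cast this
  have hHpos : (0 : ℝ) < H := by linarith
  have hH1' : (1 : ℝ) ≤ H := hH1
  -- `8T ≤ H`
  have h8T : 8 * T ≤ H := by
    have h1 : (8 : ℝ) * T ≤ 16 * β ^ A := by linarith
    have h2 : (16 : ℝ) * β ^ A ≤ β ^ θ := by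
      have : β ^ θ = β ^ (θ - A) * β ^ A := by
        rw [← Real.rpow_add hβ0]; ring_nf
      rw [this]
      exact mul_le_mul_of_nonneg_right h16 (Real.rpow_nonneg hβ0.le _)
    have : (8 : ℝ) * T ≤ H := h1.trans (h2.trans hHceil)
    exact_mod_cast this
  -- the expansion data for this `β`, `ω`
  obtain ⟨ϑ, s, henergy, hpt⟩ := hE β hβ₁ ω hω
  -- notation
  set pin : Literature.MathematicalPhysics.QuantumLattice.ZdEdge 4 → Prop := fun e => e ∉ dirFreeEdges H with hpin
  set Fb : Fin (dimE ρ) → Site 4 → ℝ := fun c x =>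
    LatticeMaxwell.sCirc (LatticeMaxwell.glue (pin := pin) dirCorner (2 * H + 3) (ϑ c)
      (LatticeMaxwell.mean pin dirCorner (2 * H + 3) (ϑ c))) (x, 1, 2) with hFb
  set Ec : Fin (dimE ρ) → ℝ := fun c => LatticeMaxwell.formM pin dirCorner (2 * H + 3) (ϑ c) (s c) with hEc
  set xt : ℕ → Site 4 := fun t => boxCentre H + Pi.single 0 (t : ℤ) with hxt
  set Em : ℕ → ℝ := fun t => ∫ U, plaqCostAt ρ (xt t) 1 2 U ∂(boxKernelG ρ β H ω) with hEm
  set Vt : ℕ → ℝ := fun t => boxDirProjKernel H (xt t, 1, 2) (xt t, 1, 2) with hVt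
  set Bt : ℕ → ℝ := fun t => ∑ c, Fb c (xt t) ^ 2 with hBt
  have hEc0 : ∀ c, 0 ≤ Ec c := fun c => by
    rw [hEc]; simp only [LatticeMaxwell.formM]; exact Finset.sum_nonneg fun p _ => sq_nonneg _
  have hnear : ∀ t : ℕ, t ≤ T → ∀ m : Fin 4, 8 * |xt t m - (H : ℤ)| ≤ (H : ℤ) := fun t ht m => near_centre_of_le h8T ht m
  -- the expansion at the points `xt t`, `t ≤ T`
  have hexp_t : ∀ t : ℕ, t ≤ T → |β * Em t - (dimE ρ : ℝ) / 2 * Vt t - β * Bt t| ≤ β ^ (-θ) := fun t ht => hpt (xt t) (hnear t ht)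
  -- interior bounds for each colour at the points `xt t`
  have hFb_d₁ : ∀ c x, Fb c x = d₁ (fun z (i : Fin 4) =>
      LatticeMaxwell.glue (pin := pin) dirCorner (2 * H + 3) (ϑ c) (LatticeMaxwell.mean pin dirCorner (2 * H + 3) (ϑ c)) (z, i))
        x 1 2 := fun c x => by rw [hFb]; exact sCirc_eq_d₁ _ _
  have hsup : ∀ c (t : ℕ), t ≤ T → |Fb c (xt t)| ≤ C * Real.sqrt (Ec c) / (H : ℝ) ^ 2 := by
    intro c t ht
    rw [hFb_d₁]
    exact (hI H hH8 (ϑ c) (s c) (xt t) (hnear t ht) 1 2).1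
  have hgrad : ∀ c (t : ℕ), t + 1 ≤ T → |Fb c (xt (t + 1)) - Fb c (xt t)| ≤ C * Real.sqrt (Ec c) / (H : ℝ) ^ 3 := by
    intro c t ht
    have h := (hI H hH8 (ϑ c) (s c) (xt t) (hnear t (by omega)) 1 2).2 0
    have hx : xt (t + 1) = xt t + Pi.single 0 1 := by
      show boxCentre H + Pi.single 0 (((t + 1 : ℕ) : ℤ)) = boxCentre H + Pi.single 0 (t : ℤ) + Pi.single 0 1
      rw [Nat.cast_succ, Pi.single_add, add_assoc]
    rw [hFb_d₁, hFb_d₁, hx]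
    exact h
  -- per-step bound on the background term
  have hstep : ∀ t : ℕ, t + 1 ≤ T → |Bt (t + 1) - Bt t| ≤ 2 * C ^ 2 * (∑ c, Ec c) / (H : ℝ) ^ 5 := by
    intro t ht
    rw [hBt]
    simp only
    rw [← Finset.sum_sub_distrib, Finset.mul_sum, Finset.sum_div]
    refine (Finset.abs_sum_le_sum_abs _ _).trans (Finset.sum_le_sum fun c _ => ?_)
    have h1 := hsup c t (by omega)
    have h2 := hsup c (t + 1) ht
    have h3 := hgrad c t ht
    have hs : Real.sqrt (Ec c) * Real.sqrt (Ec c) = Ec c := Real.mul_self_sqrt (hEc0 c)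
    set r := Real.sqrt (Ec c) with hr
    refine (abs_sq_sub_sq_le h1 h2 h3).trans (le_of_eq ?_)
    rw [← hs]
    field_simp
  -- telescope
  have htel : |Bt T - Bt 0| ≤ (T : ℝ) * (2 * C ^ 2 * (∑ c, Ec c) / (H : ℝ) ^ 5) := by
    rw [← Finset.sum_range_sub Bt T]
    refine (Finset.abs_sum_le_sum_abs _ _).trans ?_
    calc ∑ i ∈ Finset.range T, |Bt (i + 1) - Bt i| ≤ ∑ _i ∈ Finset.range T, 2 * C ^ 2 * (∑ c, Ec c) / (H : ℝ) ^ 5 :=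
          Finset.sum_le_sum fun i hi => hstep i (by have := Finset.mem_range.1 hi; omega)
      _ = (T : ℝ) * (2 * C ^ 2 * (∑ c, Ec c) / (H : ℝ) ^ 5) := by rw [Finset.sum_const, Finset.card_range, nsmul_eq_mul]
  -- energy and geometry
  have hEsum : ∑ c, Ec c ≤ CE * (2 * (H : ℝ) + 3) ^ 4 * β ^ (2 * δ - 1) := henergy
  have hgeo : (2 * (H : ℝ) + 3) ^ 4 ≤ 625 * (H : ℝ) ^ 4 := two_mul_add_three_pow_four_le hH1'
  have hβpow : 0 < β ^ (2 * δ - 1) := Real.rpow_pos_of_pos hβ0 _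
  have hH0 : (H : ℝ) ≠ 0 := hHpos.ne'
  have hEsum' : ∑ c, Ec c ≤ |CE| * (2 * (H : ℝ) + 3) ^ 4 * β ^ (2 * δ - 1) :=
    hEsum.trans (mul_le_mul_of_nonneg_right (mul_le_mul_of_nonneg_right (le_abs_self CE) (by positivity)) hβpow.le)
  have hback : β * |Bt T - Bt 0| ≤ 1250 * |CE| * C ^ 2 * (β ^ (2 * δ) * T / H) := by
    have h2δ : β ^ (2 * δ) = β * β ^ (2 * δ - 1) := by
      rw [show 2 * δ = 1 + (2 * δ - 1) by ring, Real.rpow_add hβ0, Real.rpow_one]; ring_nf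
    rw [h2δ]
    have hT0 : (0 : ℝ) ≤ T := by positivity
    have hE' : ∑ c, Ec c ≤ |CE| * (625 * (H : ℝ) ^ 4) * β ^ (2 * δ - 1) :=
      hEsum'.trans (mul_le_mul_of_nonneg_right (mul_le_mul_of_nonneg_left hgeo (abs_nonneg CE)) hβpow.le)
    have hfrac : 2 * C ^ 2 * (∑ c, Ec c) / (H : ℝ) ^ 5 ≤ 1250 * |CE| * C ^ 2 * β ^ (2 * δ - 1) / (H : ℝ) := by
      rw [div_le_div_iff₀ (by positivity) hHpos]
      calc 2 * C ^ 2 * (∑ c, Ec c) * (H : ℝ) ≤ 2 * C ^ 2 * (|CE| * (625 * (H : ℝ) ^ 4) * β ^ (2 * δ - 1)) * (H : ℝ) := by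
            gcongr
        _ = 1250 * |CE| * C ^ 2 * β ^ (2 * δ - 1) * (H : ℝ) ^ 5 := by ring
    calc β * |Bt T - Bt 0| ≤ β * ((T : ℝ) * (2 * C ^ 2 * (∑ c, Ec c) / (H : ℝ) ^ 5)) :=
          mul_le_mul_of_nonneg_left htel hβ0.le
      _ ≤ β * ((T : ℝ) * (1250 * |CE| * C ^ 2 * β ^ (2 * δ - 1) / (H : ℝ))) := by gcongr
      _ = 1250 * |CE| * C ^ 2 * (β * β ^ (2 * δ - 1) * T / H) := by ring
  -- flatness of the Dirichlet variance
  have hflatT : |Vt T - Vt 0| ≤ KN / H := hN H hHH₀ (xt T) (xt 0) (hnear T le_rfl) (hnear 0 (Nat.zero_le _))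
  have hone : (1 : ℝ) ≤ β ^ (2 * δ) * T :=
    one_le_mul_of_one_le_of_one_le (Real.one_le_rpow hβ1 (by positivity : (0 : ℝ) ≤ 2 * δ)) hT1
  have hflat' : (dimE ρ : ℝ) / 2 * |Vt T - Vt 0| ≤ (dimE ρ : ℝ) / 2 * |KN| * (β ^ (2 * δ) * T / H) := by
    have h1 : KN / H ≤ |KN| / H := div_le_div_of_nonneg_right (le_abs_self KN) hHpos.le
    have h2 : |KN| / H ≤ |KN| * (β ^ (2 * δ) * T / H) := by
      rw [mul_div_assoc', div_le_div_iff_of_pos_right hHpos]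
      exact le_mul_of_one_le_right (abs_nonneg KN) hone
    have := hflatT.trans (h1.trans h2)
    rw [mul_assoc]
    exact mul_le_mul_of_nonneg_left this (by positivity)
  -- the two expansion errors
  have herr : 2 * β ^ (-θ) ≤ 4 * (β ^ (2 * δ) * T / H) := by
    have h1 : β ^ (-θ) * (H : ℝ) ≤ 2 := by
      calc β ^ (-θ) * (H : ℝ) ≤ β ^ (-θ) * (2 * β ^ θ) := mul_le_mul_of_nonneg_left hH2 (Real.rpow_nonneg hβ0.le _)
        _ = 2 * (β ^ (-θ) * β ^ θ) := by ring
        _ = 2 := by rw [← Real.rpow_add hβ0, neg_add_cancel, Real.rpow_zero, mul_one]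
    rw [mul_div_assoc', le_div_iff₀ hHpos]
    calc 2 * β ^ (-θ) * (H : ℝ) = 2 * (β ^ (-θ) * (H : ℝ)) := by ring
      _ ≤ 2 * 2 := by linarith
      _ ≤ 4 * (β ^ (2 * δ) * T) := by linarith
  -- assemble
  have hmain : β * |Em T - Em 0| ≤ (4 + (dimE ρ : ℝ) / 2 * |KN| + 1250 * |CE| * C ^ 2) * (β ^ (2 * δ) * T / H) := by
    have e1 := hexp_t T le_rfl
    have e0 := hexp_t 0 (Nat.zero_le _)
    have hsplit : β * (Em T - Em 0) = (β * Em T - (dimE ρ : ℝ) / 2 * Vt T - β * Bt T) - (β * Em 0 - (dimE ρ : ℝ) / 2 * Vt 0 - β * Bt 0) +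
        (dimE ρ : ℝ) / 2 * (Vt T - Vt 0) + β * (Bt T - Bt 0) := by ring
    have habs : β * |Em T - Em 0| = |β * (Em T - Em 0)| := by rw [abs_mul, abs_of_pos hβ0]
    rw [habs, hsplit]
    have hβB : |β * (Bt T - Bt 0)| = β * |Bt T - Bt 0| := by rw [abs_mul, abs_of_pos hβ0]
    have h32 : |(dimE ρ : ℝ) / 2 * (Vt T - Vt 0)| = (dimE ρ : ℝ) / 2 * |Vt T - Vt 0| := by rw [abs_mul, abs_of_nonneg (by positivity : (0 : ℝ) ≤ (dimE ρ : ℝ) / 2)]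
    calc |β * Em T - (dimE ρ : ℝ) / 2 * Vt T - β * Bt T - (β * Em 0 - (dimE ρ : ℝ) / 2 * Vt 0 - β * Bt 0) + (dimE ρ : ℝ) / 2 * (Vt T - Vt 0) + β * (Bt T - Bt 0)|
        ≤ |β * Em T - (dimE ρ : ℝ) / 2 * Vt T - β * Bt T - (β * Em 0 - (dimE ρ : ℝ) / 2 * Vt 0 - β * Bt 0) + (dimE ρ : ℝ) / 2 * (Vt T - Vt 0)| + |β * (Bt T - Bt 0)| :=
          abs_add_le _ _
      _ ≤ (|β * Em T - (dimE ρ : ℝ) / 2 * Vt T - β * Bt T - (β * Em 0 - (dimE ρ : ℝ) / 2 * Vt 0 - β * Bt 0)| + |(dimE ρ : ℝ) / 2 * (Vt T - Vt 0)|) + |β * (Bt T - Bt 0)| := by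
          gcongr; exact abs_add_le _ _
      _ ≤ ((|β * Em T - (dimE ρ : ℝ) / 2 * Vt T - β * Bt T| + |β * Em 0 - (dimE ρ : ℝ) / 2 * Vt 0 - β * Bt 0|) + |(dimE ρ : ℝ) / 2 * (Vt T - Vt 0)|) + |β * (Bt T - Bt 0)| := by
          gcongr; exact abs_sub _ _
      _ ≤ ((β ^ (-θ) + β ^ (-θ)) + (dimE ρ : ℝ) / 2 * |KN| * (β ^ (2 * δ) * T / H)) + 1250 * |CE| * C ^ 2 * (β ^ (2 * δ) * T / H) := by
          rw [hβB, h32]; gcongr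
      _ ≤ (4 + (dimE ρ : ℝ) / 2 * |KN| + 1250 * |CE| * C ^ 2) * (β ^ (2 * δ) * T / H) := by linarith [herr, hflat', hback]
  -- conclude: divide by β
  have hgoal : |Em T - Em 0| ≤ (4 + (dimE ρ : ℝ) / 2 * |KN| + 1250 * |CE| * C ^ 2) * β ^ (2 * δ - 1) * (T : ℝ) / (H : ℝ) := by
    have h2δ : β ^ (2 * δ) = β * β ^ (2 * δ - 1) := by
      rw [show 2 * δ = 1 + (2 * δ - 1) by ring, Real.rpow_add hβ0, Real.rpow_one]; ring_nf
    rw [h2δ] at hmain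
    have : β * |Em T - Em 0| ≤ β * ((4 + (dimE ρ : ℝ) / 2 * |KN| + 1250 * |CE| * C ^ 2) * β ^ (2 * δ - 1) * (T : ℝ) / (H : ℝ)) := by
      calc β * |Em T - Em 0| ≤ _ := hmain
        _ = β * ((4 + (dimE ρ : ℝ) / 2 * |KN| + 1250 * |CE| * C ^ 2) * β ^ (2 * δ - 1) * (T : ℝ) / (H : ℝ)) := by ring
    exact le_of_mul_le_mul_left this hβ0
  -- match the statement of `GoodBoundaryMeanSmooth`
  have hx0 : xt 0 = boxCentre H := by rw [hxt]; simp
  have hEm0 : Em 0 = ∫ U, plaqCostAt ρ (boxCentre H) 1 2 U ∂(boxKernelG ρ β H ω) := by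
    rw [hEm]; simp only [hx0]
  have hEmT : Em T = ∫ U, plaqCostAt ρ (boxCentre H + Pi.single 0 (T : ℤ)) 1 2 U ∂(boxKernelG ρ β H ω) := by
    rw [hEm]
  rw [hEm0, hEmT] at hgoal
  simpa only [hHdef, hTdef, hδ, hA] using hgoal




/-- **L1b-G ⇐ `KernelMeanExpansionG` ∧ `DirKernelDiagFlat`** (the NAMED interfaces: `KernelMeanExpansionG` of
`Theorems/ColdBoxAllGroupsDefs.lean`, appended 2026-08-27, and the G-free `DirKernelDiagFlat` of the `SU(2)` Defs, LANDED as
`dirKernelDiagFlat`): the registered stub `stub_goodBoundaryMeanSmoothG` of the line `dlr-chessboard-G` follows, for each `(G, ρ)`, from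
«one-scale kernel mean expansion along `δ = θ/5` below a ceiling» and «flat Dirichlet variance near the centre». [folklore] -/
theorem goodBoundaryMeanSmoothG_of_kernelMeanExpansionG
    (hexp : ∃ θ₂ : ℝ, 0 < θ₂ ∧ ∀ θ : ℝ, 0 < θ → θ ≤ θ₂ → KernelMeanExpansionG ρ θ (θ / 5))
    (hflat : DirKernelDiagFlat) :
    ∃ θ₁ : ℝ, 0 < θ₁ ∧ ∀ θ : ℝ, 0 < θ → θ ≤ θ₁ → GoodBoundaryMeanSmoothG ρ (θ / 20) θ (θ / 5) := by
  obtain ⟨θ₂, hθ₂, h⟩ := hexp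
  unfold KernelMeanExpansionG at h
  unfold DirKernelDiagFlat at hflat
  exact goodBoundaryMeanSmoothG_of_expansion_explicit ρ hθ₂ h hflat

end Summit.QuantumFields.YangMills.Theorems.ColdBoxAllGroups

end
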